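import Summits.CriticalPhenomena.PercolationContinuityZ3.Theorems.PercNearOneGluingNoHeavyLowerTailSahiCTCTwistedKleitman

/-!
# `NoHeavyLowerTail` (crux stmt-CriticalPhenomena-4575), P3 lane: the twisted Kleitman inequality for GAP-CLOSED families

Support file (seat `prim-l12-p3`, gen 38; `--supports stmt-CriticalPhenomena-4575`).  Memo
`run/shared/lean/prim/prim-l12/FROM-prim-l12-p3-g38-ENTANGLEMENT.md` §9 (the gap-transport conjecture).

gen 35's THEOREM `SahiCTCTwistedKleitman.card_compl_mem_le_card_psi_mem` (the squarefree `t = 1` row of the ordered conjecture (R*))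
assumes `𝒜, ℬ` are up-sets.  Its proof uses monotonicity only in the form "a member stays a member when an element BELOW all of its
elements is inserted".  This file records the theorem under exactly that hypothesis (`insert a W ∈ 𝒜` whenever `W ∈ 𝒜` and `a < w`
for all `w ∈ W`; same for `ℬ`) — the `t = 1` case of the families that gen 38 calls `t`-GAP-CLOSED (closed under inserting an
element below the `t`-th smallest one), for which the whole ordered family `Φ(s,u) ≥ 0`, `s ≤ u`, is conjectured (memo §9; it
strictly strengthens (R*) and holds in every census).  Example of a gap-closed family that is not an up-set: `{W : max W = v}`.
Proof: gen 35's induction on `#R` peeling the minimum, verbatim, with the two uses of `IsUpperSet` replaced by the hypothesis.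
Nothing is asserted about the crux.
-/

namespace Summit.CriticalPhenomena.PercolationContinuityZ3.Theorems

namespace SahiCTCTwistedKleitmanGap

open Finset SahiCTCTwistedKleitman

variable {α : Type*} [LinearOrder α]

/-- **TWISTED KLEITMAN FOR GAP-CLOSED FAMILIES** (gen 38): if `𝒜` and `ℬ` are families of finite subsets of a linear order that
are closed under inserting an element lying below all elements of a member (`W ∈ 𝒜`, `a < w ∀ w ∈ W` ⇒ `insert a W ∈ 𝒜`; every
up-set is such a family), then for every finite `R`,
`#{W ⊆ R : W ≠ ∅, W ∈ 𝒜, R \\ W ∈ ℬ} ≤ #{W ⊆ R : W ≠ ∅, W ∈ 𝒜, ψ_R(W) ∈ ℬ}`, `ψ_R(W) = {min W} ∪ {x ∈ R \\ W : min W < x}`. [this work] -/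
theorem card_compl_mem_le_card_psi_mem_of_insert_below (𝒜 ℬ : Finset (Finset α))
    (h𝒜 : ∀ (a : α) (W : Finset α), W ∈ 𝒜 → (∀ w ∈ W, a < w) → insert a W ∈ 𝒜)
    (hℬ : ∀ (a : α) (W : Finset α), W ∈ ℬ → (∀ w ∈ W, a < w) → insert a W ∈ ℬ) (R : Finset α) :
    (R.powerset.filter fun W => W.Nonempty ∧ W ∈ 𝒜 ∧ R \ W ∈ ℬ).card ≤
      (R.powerset.filter fun W => W.Nonempty ∧ W ∈ 𝒜 ∧ (Finset.filter (fun v => (v ∈ W ∧ ∀ w ∈ W, v ≤ w) ∨ (v ∉ W ∧ ∃ w ∈ W, w < v)) (R)) ∈ ℬ).card := by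
  -- induction on the size of `R`, for all up-sets `𝒜` (ℬ fixed)
  suffices key : ∀ (n : ℕ) (R : Finset α) (𝒜 : Finset (Finset α)), R.card = n →
      (∀ (a : α) (W : Finset α), W ∈ 𝒜 → (∀ w ∈ W, a < w) → insert a W ∈ 𝒜) →
      (R.powerset.filter fun W => W.Nonempty ∧ W ∈ 𝒜 ∧ R \ W ∈ ℬ).card ≤
        (R.powerset.filter fun W => W.Nonempty ∧ W ∈ 𝒜 ∧ (Finset.filter (fun v => (v ∈ W ∧ ∀ w ∈ W, v ≤ w) ∨ (v ∉ W ∧ ∃ w ∈ W, w < v)) (R)) ∈ ℬ).card from key R.card R 𝒜 rfl h𝒜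
  intro n
  induction n with
  | zero =>
    intro R 𝒜 hR _
    rw [card_eq_zero] at hR
    subst hR
    simp only [powerset_empty, filter_singleton, Finset.not_nonempty_empty, false_and, if_false, card_empty, le_refl]
  | succ n ih =>
    intro R 𝒜 hR h𝒜
    have hRne : R.Nonempty := by rw [← card_pos, hR]; exact Nat.succ_pos n
    set a := R.min' hRne with ha_def
    set R' := R.erase a with hR'_def
    have haR : a ∈ R := min'_mem R hRne
    have haR' : a ∉ R' := by rw [hR'_def]; exact notMem_erase a R
    have hRR' : R = insert a R' := by rw [hR'_def, insert_erase haR]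
    have hcard : R'.card = n := by
      rw [hR'_def, card_erase_of_mem haR, hR]; rfl
    have hlt : ∀ x ∈ R', a < x := by
      intro x hx
      rw [hR'_def, mem_erase] at hx
      exact lt_of_le_of_ne (min'_le R x hx.2) (Ne.symm hx.1)
    -- the induction hypothesis for (R', 𝒜)
    have IH := ih R' 𝒜 hcard h𝒜
    -- split the powerset of R = insert a R'
    rw [hRR', powerset_insert]
    have hdisj : Disjoint R'.powerset (R'.powerset.image (insert a)) := by
      rw [disjoint_left]
      intro W hW hW'
      rw [mem_image] at hW'
      obtain ⟨W', _, rfl⟩ := hW'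
      exact haR' (mem_powerset.mp hW (mem_insert_self a W'))
    rw [filter_union, filter_union, card_union_of_disjoint (disjoint_filter_filter hdisj),
      card_union_of_disjoint (disjoint_filter_filter hdisj)]
    -- the parts over `W ⊆ R'` (not containing `a`)
    have part0L : (R'.powerset.filter fun W => W.Nonempty ∧ W ∈ 𝒜 ∧ insert a R' \ W ∈ ℬ) =
        R'.powerset.filter fun W => W.Nonempty ∧ W ∈ 𝒜 ∧ insert a (R' \ W) ∈ ℬ := by
      apply filter_congr
      intro W hW
      rw [insert_sdiff_of_notMem R' (fun h => haR' (mem_powerset.mp hW h))]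
    have part0R : (R'.powerset.filter fun W => W.Nonempty ∧ W ∈ 𝒜 ∧ (Finset.filter (fun v => (v ∈ W ∧ ∀ w ∈ W, v ≤ w) ∨ (v ∉ W ∧ ∃ w ∈ W, w < v)) (insert a R')) ∈ ℬ) =
        R'.powerset.filter fun W => W.Nonempty ∧ W ∈ 𝒜 ∧ (Finset.filter (fun v => (v ∈ W ∧ ∀ w ∈ W, v ≤ w) ∨ (v ∉ W ∧ ∃ w ∈ W, w < v)) (R')) ∈ ℬ := by
      apply filter_congr
      intro W hW
      rw [psi_insert_of_subset hlt (mem_powerset.mp hW)]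
    -- the parts over `W = insert a W'`
    have hinj : Set.InjOn (insert a) (R'.powerset : Set (Finset α)) := by
      intro W₁ hW₁ W₂ hW₂ h
      have h1 : a ∉ W₁ := fun hh => haR' (mem_powerset.mp (mem_coe.mp hW₁) hh)
      have h2 : a ∉ W₂ := fun hh => haR' (mem_powerset.mp (mem_coe.mp hW₂) hh)
      rw [← erase_insert h1, ← erase_insert h2, h]
    have part1L : ((R'.powerset.image (insert a)).filter fun W => W.Nonempty ∧ W ∈ 𝒜 ∧ insert a R' \ W ∈ ℬ).card =
        (R'.powerset.filter fun W' => insert a W' ∈ 𝒜 ∧ R' \ W' ∈ ℬ).card := by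
      rw [filter_image, card_image_of_injOn (fun x hx y hy h => hinj (mem_coe.mpr (mem_filter.mp (mem_coe.mp hx)).1)
        (mem_coe.mpr (mem_filter.mp (mem_coe.mp hy)).1) h)]
      congr 1
      apply filter_congr
      intro W' hW'
      simp only [insert_nonempty, true_and]
      rw [insert_sdiff_insert, sdiff_insert_of_notMem haR']
    have part1R : ((R'.powerset.image (insert a)).filter fun W => W.Nonempty ∧ W ∈ 𝒜 ∧ (Finset.filter (fun v => (v ∈ W ∧ ∀ w ∈ W, v ≤ w) ∨ (v ∉ W ∧ ∃ w ∈ W, w < v)) (insert a R')) ∈ ℬ).card =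
        (R'.powerset.filter fun W' => insert a W' ∈ 𝒜 ∧ insert a (R' \ W') ∈ ℬ).card := by
      rw [filter_image, card_image_of_injOn (fun x hx y hy h => hinj (mem_coe.mpr (mem_filter.mp (mem_coe.mp hx)).1)
        (mem_coe.mpr (mem_filter.mp (mem_coe.mp hy)).1) h)]
      congr 1
      apply filter_congr
      intro W' hW'
      simp only [insert_nonempty, true_and]
      rw [psi_insert_insert hlt (mem_powerset.mp hW')]
    rw [part0L, part0R, part1L, part1R]
    -- X1 + X2 ≤ Y1 + Y2 via X2 = X2' + M2, Y1 = X1 + M1, M2 ≤ M1, X2' ≤ Y2 (IH)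
    have splitX2 : (R'.powerset.filter fun W => W.Nonempty ∧ W ∈ 𝒜 ∧ insert a (R' \ W) ∈ ℬ).card =
        (R'.powerset.filter fun W => W.Nonempty ∧ W ∈ 𝒜 ∧ R' \ W ∈ ℬ).card +
        (R'.powerset.filter fun W => (W.Nonempty ∧ W ∈ 𝒜 ∧ insert a (R' \ W) ∈ ℬ) ∧ R' \ W ∉ ℬ).card := by
      rw [← card_filter_add_card_filter_not (s := R'.powerset.filter fun W => W.Nonempty ∧ W ∈ 𝒜 ∧ insert a (R' \ W) ∈ ℬ)
        (p := fun W => R' \ W ∈ ℬ)]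
      rw [filter_filter, filter_filter]
      congr 2
      apply filter_congr
      intro W _
      constructor
      · rintro ⟨⟨h1, h2, _⟩, h4⟩; exact ⟨h1, h2, h4⟩
      · rintro ⟨h1, h2, h3⟩; exact ⟨⟨h1, h2, hℬ a _ h3 (fun w hw => hlt w (mem_sdiff.mp hw).1)⟩, h3⟩
    have splitY1 : (R'.powerset.filter fun W' => insert a W' ∈ 𝒜 ∧ insert a (R' \ W') ∈ ℬ).card =
        (R'.powerset.filter fun W' => insert a W' ∈ 𝒜 ∧ R' \ W' ∈ ℬ).card +
        (R'.powerset.filter fun W' => (insert a W' ∈ 𝒜 ∧ insert a (R' \ W') ∈ ℬ) ∧ R' \ W' ∉ ℬ).card := by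
      rw [← card_filter_add_card_filter_not (s := R'.powerset.filter fun W' => insert a W' ∈ 𝒜 ∧ insert a (R' \ W') ∈ ℬ)
        (p := fun W => R' \ W ∈ ℬ)]
      rw [filter_filter, filter_filter]
      congr 2
      apply filter_congr
      intro W _
      constructor
      · rintro ⟨⟨h1, _⟩, h4⟩; exact ⟨h1, h4⟩
      · rintro ⟨h1, h3⟩; exact ⟨⟨h1, hℬ a _ h3 (fun w hw => hlt w (mem_sdiff.mp hw).1)⟩, h3⟩
    have M2leM1 : (R'.powerset.filter fun W => (W.Nonempty ∧ W ∈ 𝒜 ∧ insert a (R' \ W) ∈ ℬ) ∧ R' \ W ∉ ℬ).card ≤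
        (R'.powerset.filter fun W' => (insert a W' ∈ 𝒜 ∧ insert a (R' \ W') ∈ ℬ) ∧ R' \ W' ∉ ℬ).card := by
      apply card_le_card
      intro W hW
      rw [mem_filter] at hW ⊢
      obtain ⟨hW, ⟨_, h2, h3⟩, h4⟩ := hW
      exact ⟨hW, ⟨h𝒜 a W h2 (fun w hw => hlt w (mem_powerset.mp hW hw)), h3⟩, h4⟩
    rw [splitX2, splitY1]
    omega

end SahiCTCTwistedKleitmanGap

namespace SahiCTCTwistedKleitmanGap

open Finset

variable {α : Type*} [LinearOrder α]

/-- Up-sets are closed under inserting an element below all elements of a member (indeed under inserting any element), so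
`card_compl_mem_le_card_psi_mem_of_insert_below` contains gen 35's twisted Kleitman inequality. [this work] -/
theorem insert_below_closed_of_isUpperSet {𝒜 : Finset (Finset α)} (h𝒜 : IsUpperSet (𝒜 : Set (Finset α))) :
    ∀ (a : α) (W : Finset α), W ∈ 𝒜 → (∀ w ∈ W, a < w) → insert a W ∈ 𝒜 := by
  intro a W hW _
  exact h𝒜 (subset_insert a W) hW

end SahiCTCTwistedKleitmanGap

end Summit.CriticalPhenomena.PercolationContinuityZ3.Theorems
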